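import Literature.Topology.FourManifolds.FlowExtension
import Literature.Topology.FourManifolds.SublevelDiffeoAmbient
import Literature.Topology.FourManifolds.RelatedFlows
import HarnessLib

/-!
# Extending a lower correspondence upward along unit-speed flows, level by level

Topic `Literature/Topology/FourManifolds` (fact seat
`provefact-Literature.Topology.FourManifolds.IsHandlebody.exists_diffeomorph_isBoundaryGluing_sphere`,
step F2b₁ of the Lickorish–Wallace DAG; level step H3 of the reduction of L1
`oneHandle_nonempty_diffeomorph`, see `HandleAttachmentNormalisation.lean`).  Everything here is
**proved**; no named facts.

`FlowExtension.lean` (`Literature.Topology.FourManifolds.LowerData.low`) extends a map `g`,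
given below a level `a` of a unit-speed band of width `7η`, which shifts levels and conjugates
the flows on the collar `f⁻¹(a - 5η, a - η)`, to the *lower correspondence* `low`, with the same
properties one width higher (`apply_low`, `low_flow`, `contMDiffOn_low`, `low'_low` on
`f⁻¹(a - 5η, a + η)`).  Here this one-step extension is **iterated along a unit-speed slab**
`f⁻¹(lo, hi)` (`UnitSlab`): the hypotheses of `LowerData` on the pair `(g, g')` at level `a` and
width `η` are bundled as the proposition `IsLowerPair S S' σ a η g g'`; one step produces a
lower pair at any level `a₁ ∈ [a, a + η]` of any width `η₁ ≤ η` with `a - 5η ≤ a₁ - 6η₁`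
(`IsLowerPair.step`), and finitely many steps climb from a seed pair at level `c + τ` (bands
`f⁻¹(c - τ, c + τ)`) to any level `A` below the top of the slab (`IsLowerPair.exists_extend`).
The extension agrees with the seed below the level `c`, and — the point of the construction — it
is **the flow conjugate of the seed** all the way up:
`g x = θ' (f x - c, g₀ (θ (c - f x, x)))` for `c ≤ f x < A` (so that its values on the feet of a
handle are read off from the seed at the level `c`).  This is Milnor's extension of a
diffeomorphism of sublevel sets "by following the trajectories" (Milnor 1965, proof of Thm. 3.4,
PDF p. 13, and of Thm. 3.13, PDF pp. 18–19), organised for the tree's `LowerData`.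

Finally, **the seed**: a diffeomorphism `Ψ₁ : {f ≤ b} ≅ {f' ≤ b'}` of sublevel sets with
`f' ∘ Ψ₁ = f + σ`, read on the ambient manifolds (`SublevelDiffeoAmbient.lean`), is a lower pair
at every level `c + τ < b` of width `τ/3` as soon as the field of `M` is `Ψ₁`-related to the
field of `M'` on the collar `f⁻¹(c - τ, c + τ)` (as it is when it is the pulled-back field
there): the flows are then conjugated on the collar by naturality of flows
(`RelatedFlows.lean`, Lee 2013, Prop. 9.13) — `IsLowerPair.seed`.

## References

* J. Milnor, *Lectures on the h-cobordism theorem* (1965), proofs of Thm. 3.4 (PDF p. 13) and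
  Thm. 3.13 (PDF pp. 18–19). [MilnorHCobordism1965]
* J. M. Lee, *Introduction to Smooth Manifolds*, 2nd ed. (2013), Thm. 9.12, Prop. 9.13.
  [LeeSmoothManifolds2013]
-/

open scoped Manifold ContDiff Topology
open Set Function Filter Metric

noncomputable section

namespace Literature.Topology.FourManifolds

universe u

variable {n : ℕ} {M : Type u} [TopologicalSpace M] [ChartedSpace (EuclideanHalfSpace (n + 1)) M]
  {M' : Type u} [TopologicalSpace M'] [ChartedSpace (EuclideanHalfSpace (n + 1)) M']

/-! ### Unit-speed slabs -/

variable (M) in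
/-- **A unit-speed slab**: a smooth function `f`, a vector field `X` with a smooth global flow
`θ`, and levels `lo < hi` with `X(f) = 1` on `f⁻¹(lo, hi)`.
[cite: MilnorHCobordism1965, proof of Thm. 3.4 (PDF p. 13)] -/
structure UnitSlab where
  /-- The function. -/
  f : M → ℝ
  /-- The field. -/
  X : Π x : M, TangentSpace (𝓡∂ (n + 1)) x
  /-- Its flow. -/
  θ : ℝ × M → M
  hf : ContMDiff (𝓡∂ (n + 1)) 𝓘(ℝ, ℝ) ∞ f
  flow : IsSmoothFlow (𝓡∂ (n + 1)) X θ
  /-- The bottom of the slab. -/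
  lo : ℝ
  /-- The top of the slab. -/
  hi : ℝ
  lo_lt_hi : lo < hi
  unit : ∀ x, f x ∈ Ioo lo hi → mlineDeriv (𝓡∂ (n + 1)) f x (X x) = 1

namespace UnitSlab

variable (S : UnitSlab (n := n) M)

/-- **A band of the slab**: the unit-speed band of level `a` and width `η` with
`lo ≤ a - 6η`, `a + η ≤ hi`. [folklore] -/
def band (a η : ℝ) (hη : 0 < η) (hlo : S.lo ≤ a - 6 * η) (hhi : a + η ≤ S.hi) : UnitBand (n := n) M where
  f := S.f
  X := S.X
  θ := S.θ
  hf := S.hf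
  flow := S.flow
  a := a
  η := η
  η_pos := hη
  unit x hx := S.unit x ⟨lt_of_le_of_lt hlo hx.1, lt_of_lt_of_le hx.2 hhi⟩

/-- The whole slab as one band (`a = hi - w`, `η = w`, `7w = hi - lo`). [folklore] -/
def slabBand : UnitBand (n := n) M :=
  S.band (S.hi - (S.hi - S.lo) / 7) ((S.hi - S.lo) / 7) (div_pos (sub_pos.2 S.lo_lt_hi) (by norm_num))
    (le_of_eq (by ring)) (le_of_eq (by ring))

/-- The flow of a slab is a flow. [folklore] -/
theorem isFlowOf : IsFlowOf (𝓡∂ (n + 1)) S.X S.θ := S.flow.isFlowOf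

/-- **The clock of a unit-speed slab**: `f (θ (t, x)) = f x + t` while the levels `f x`,
`f x + t` lie in the slab. [cite: MilnorHCobordism1965, proof of Thm. 3.4 (PDF p. 13)] -/
theorem apply_flow {x : M} (hx : S.f x ∈ Ioo S.lo S.hi) {t : ℝ} (ht : S.f x + t ∈ Ioo S.lo S.hi) :
    S.f (S.θ (t, x)) = S.f x + t := by
  have e1 : S.hi - (S.hi - S.lo) / 7 - 6 * ((S.hi - S.lo) / 7) = S.lo := by ring
  have e2 : S.hi - (S.hi - S.lo) / 7 + (S.hi - S.lo) / 7 = S.hi := by ring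
  have hx' : S.slabBand.f x ∈ Ioo (S.slabBand.a - 6 * S.slabBand.η) (S.slabBand.a + S.slabBand.η) := by
    show S.f x ∈ Ioo (S.hi - (S.hi - S.lo) / 7 - 6 * ((S.hi - S.lo) / 7)) (S.hi - (S.hi - S.lo) / 7 + (S.hi - S.lo) / 7)
    rw [e1, e2]; exact hx
  have ht' : S.slabBand.f x + t ∈ Ioo (S.slabBand.a - 6 * S.slabBand.η) (S.slabBand.a + S.slabBand.η) := by
    show S.f x + t ∈ Ioo (S.hi - (S.hi - S.lo) / 7 - 6 * ((S.hi - S.lo) / 7)) (S.hi - (S.hi - S.lo) / 7 + (S.hi - S.lo) / 7)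
    rw [e1, e2]; exact ht
  exact S.slabBand.apply_flow hx' ht'

/-- Flowing down to a level and back. [folklore] -/
theorem flow_neg_flow (t : ℝ) (x : M) : S.θ (-t, S.θ (t, x)) = x := S.flow.apply_neg_apply t x

/-- Flowing back from a level. [folklore] -/
theorem flow_flow_neg (t : ℝ) (x : M) : S.θ (t, S.θ (-t, x)) = x := by
  have := S.flow.apply_neg_apply (-t) x; rwa [neg_neg] at this

end UnitSlab

/-! ### Lower pairs -/

/-- **A lower pair at level `a`, width `η`, shift `σ`**: the hypotheses of
`Literature.Topology.FourManifolds.LowerData` on `(g, g')` for the bands of level `a` of `S` and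
`a + σ` of `S'`: smooth below the levels, shifting levels by `σ` on the collars of width `6η`,
deep points to deep points, inverse to each other below the levels, and conjugating the flows on
the collars `f⁻¹(a - 5η, a - η)`. [cite: MilnorHCobordism1965, proof of Thm. 3.13 (PDF pp. 18–19)] -/
structure IsLowerPair (S : UnitSlab (n := n) M) (S' : UnitSlab (n := n) M') (σ a η : ℝ)
    (g : M → M') (g' : M' → M) : Prop where
  g_smooth : ContMDiffOn (𝓡∂ (n + 1)) (𝓡∂ (n + 1)) ∞ g {x | S.f x < a}
  g'_smooth : ContMDiffOn (𝓡∂ (n + 1)) (𝓡∂ (n + 1)) ∞ g' {y | S'.f y < a + σ}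
  apply_g : ∀ x, S.f x ∈ Ioo (a - 6 * η) a → S'.f (g x) = S.f x + σ
  apply_g' : ∀ y, S'.f y ∈ Ioo (a + σ - 6 * η) (a + σ) → S.f (g' y) = S'.f y - σ
  g_below : ∀ x, S.f x ≤ a - 5 * η → S'.f (g x) ≤ a + σ - 4 * η
  g'_below : ∀ y, S'.f y ≤ a + σ - 5 * η → S.f (g' y) ≤ a - 4 * η
  g'_g : ∀ x, S.f x < a → g' (g x) = x
  g_g' : ∀ y, S'.f y < a + σ → g (g' y) = y
  g_flow : ∀ x t, S.f x ∈ Ioo (a - 5 * η) (a - η) → S.f x + t ∈ Ioo (a - 5 * η) (a - η) →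
    g (S.θ (t, x)) = S'.θ (t, g x)
  g'_flow : ∀ y t, S'.f y ∈ Ioo (a + σ - 5 * η) (a + σ - η) →
    S'.f y + t ∈ Ioo (a + σ - 5 * η) (a + σ - η) → g' (S'.θ (t, y)) = S.θ (t, g' y)

namespace IsLowerPair

variable {S : UnitSlab (n := n) M} {S' : UnitSlab (n := n) M'} {σ a η : ℝ} {g : M → M'} {g' : M' → M}
  (h : IsLowerPair S S' σ a η g g') (hη : 0 < η) (hlo : S.lo ≤ a - 6 * η) (hhi : a + η ≤ S.hi)
  (hlo' : S'.lo ≤ a + σ - 6 * η) (hhi' : a + σ + η ≤ S'.hi)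

/-- **The `LowerData` of a lower pair.** [cite: MilnorHCobordism1965, proof of Thm. 3.13 (PDF pp. 18–19)] -/
def lowerData : LowerData (n := n) M M' where
  B := S.band a η hη hlo hhi
  B' := S'.band (a + σ) η hη hlo' hhi'
  hη := rfl
  g := g
  g' := g'
  g_smooth := h.g_smooth
  g'_smooth := h.g'_smooth
  apply_g x hx := by
    show S'.f (g x) = S.f x + (a + σ - a)
    rw [h.apply_g x hx]; ring
  apply_g' y hy := by
    show S.f (g' y) = S'.f y + (a - (a + σ))
    rw [h.apply_g' y hy]; ring
  g_below := h.g_below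
  g'_below := h.g'_below
  g'_g := h.g'_g
  g_g' := h.g_g'
  g_flow := h.g_flow
  g'_flow := h.g'_flow

/-- The shift of the `LowerData`. [folklore] -/
@[simp] theorem lowerData_σ : (h.lowerData hη hlo hhi hlo' hhi').σ = σ := by
  show a + σ - a = σ; ring

/-- The extended map agrees with `g` below `a - 3η`. [folklore] -/
theorem low_eq {x : M} (hx : S.f x ≤ a - 3 * η) : (h.lowerData hη hlo hhi hlo' hhi').low x = g x :=
  (h.lowerData hη hlo hhi hlo' hhi').low_of_le hx

/-- The extended inverse agrees with `g'` below `a + σ - 3η`. [folklore] -/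
theorem low'_eq {y : M'} (hy : S'.f y ≤ a + σ - 3 * η) : (h.lowerData hη hlo hhi hlo' hhi').low' y = g' y :=
  (h.lowerData hη hlo hhi hlo' hhi').swap.low_of_le hy

/-- **One step up**: the lower correspondence of a lower pair at level `a`, width `η`, is a
lower pair at any level `a₁ ∈ [a, a + η]` of any width `η₁` with `a - 5η ≤ a₁ - 6η₁`.
[cite: MilnorHCobordism1965, proof of Thm. 3.13 (PDF pp. 18–19)] -/
theorem step {a₁ η₁ : ℝ} (hη₁ : 0 < η₁) (ha₁ : a ≤ a₁) (ha₁' : a₁ ≤ a + η)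
    (hb : a - 5 * η ≤ a₁ - 6 * η₁) :
    IsLowerPair S S' σ a₁ η₁ (h.lowerData hη hlo hhi hlo' hhi').low (h.lowerData hη hlo hhi hlo' hhi').low' := by
  set L := h.lowerData hη hlo hhi hlo' hhi' with hL
  have hσ : L.σ = σ := h.lowerData_σ hη hlo hhi hlo' hhi'
  have hσ' : L.swap.σ = -σ := by show a - (a + σ) = -σ; ring
  refine
    { g_smooth := L.contMDiffOn_low.mono fun x hx => ?_
      g'_smooth := L.swap.contMDiffOn_low.mono fun y hy => ?_
      apply_g := fun x hx => ?_
      apply_g' := fun y hy => ?_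
      g_below := fun x hx => ?_
      g'_below := fun y hy => ?_
      g'_g := fun x hx => L.low'_low (show S.f x < a + η by
        have hx' : S.f x < a₁ := hx
        linarith)
      g_g' := fun y hy => L.swap.low'_low (show S'.f y < a + σ + η by
        have hy' : S'.f y < a₁ + σ := hy
        linarith)
      g_flow := fun x t hx ht => L.low_flow
        ⟨by show a - 5 * η < S.f x; linarith [hx.1], by show S.f x < a + η; linarith [hx.2]⟩
        ⟨by show a - 5 * η < S.f x + t; linarith [ht.1], by show S.f x + t < a + η; linarith [ht.2]⟩
      g'_flow := fun y t hy ht => L.swap.low_flow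
        ⟨by show a + σ - 5 * η < S'.f y; linarith [hy.1], by show S'.f y < a + σ + η; linarith [hy.2]⟩
        ⟨by show a + σ - 5 * η < S'.f y + t; linarith [ht.1], by show S'.f y + t < a + σ + η; linarith [ht.2]⟩ }
  · have hx' : S.f x < a₁ := hx
    show S.f x < a + η
    linarith
  · have hy' : S'.f y < a₁ + σ := hy
    show S'.f y < a + σ + η
    linarith
  · have h1 : S'.f (L.low x) = S.f x + σ := by
      have := L.apply_low (x := x)
        ⟨by show a - 5 * η < S.f x; linarith [hx.1], by show S.f x < a + η; linarith [hx.2]⟩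
      rw [hσ] at this; exact this
    exact h1
  · have h1 : S.f (L.swap.low y) = S'.f y + -σ := by
      have := L.swap.apply_low (x := y)
        ⟨by show a + σ - 5 * η < S'.f y; linarith [hy.1], by show S'.f y < a + σ + η; linarith [hy.2]⟩
      rw [hσ'] at this; exact this
    show S.f (L.swap.low y) = S'.f y - σ
    rw [h1]; ring
  · by_cases h5 : S.f x ≤ a - 5 * η
    · show S'.f (L.low x) ≤ a₁ + σ - 4 * η₁
      rw [L.low_of_le (show S.f x ≤ a - 3 * η by linarith)]
      show S'.f (g x) ≤ a₁ + σ - 4 * η₁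
      linarith [h.g_below x h5]
    · have h1 : S'.f (L.low x) = S.f x + σ := by
        have := L.apply_low (x := x) ⟨lt_of_not_ge h5, by show S.f x < a + η; linarith⟩
        rw [hσ] at this; exact this
      show S'.f (L.low x) ≤ a₁ + σ - 4 * η₁
      rw [h1]; linarith
  · by_cases h5 : S'.f y ≤ a + σ - 5 * η
    · show S.f (L.swap.low y) ≤ a₁ - 4 * η₁
      rw [L.swap.low_of_le (show S'.f y ≤ a + σ - 3 * η by linarith)]
      show S.f (g' y) ≤ a₁ - 4 * η₁
      linarith [h.g'_below y h5]
    · have h1 : S.f (L.swap.low y) = S'.f y + -σ := by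
        have := L.swap.apply_low (x := y) ⟨lt_of_not_ge h5, by show S'.f y < a + σ + η; linarith⟩
        rw [hσ'] at this; exact this
      show S.f (L.swap.low y) ≤ a₁ - 4 * η₁
      rw [h1]; linarith

/-- **The extension is the flow conjugate of the seed.**  If `g` is the flow conjugate of a seed
`g₀` at the level `c` on `c ≤ f < a - η` (`c ≤ a - 2η`), then so is `low` on
`c ≤ f < a + η`. [cite: MilnorHCobordism1965, proof of Thm. 3.4 (PDF p. 13)] -/
theorem low_eq_conj {c : ℝ} {g₀ : M → M'} (hca : c ≤ a - 2 * η)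
    (hinv : ∀ x, c ≤ S.f x → S.f x < a - η → g x = S'.θ (S.f x - c, g₀ (S.θ (c - S.f x, x))))
    {x : M} (hcx : c ≤ S.f x) (hxa : S.f x < a + η) :
    (h.lowerData hη hlo hhi hlo' hhi').low x = S'.θ (S.f x - c, g₀ (S.θ (c - S.f x, x))) := by
  set L := h.lowerData hη hlo hhi hlo' hhi' with hL
  by_cases h3 : S.f x ≤ a - 3 * η
  · rw [L.low_of_le h3]
    exact hinv x hcx (by linarith)
  · rw [L.low_of_lt (lt_of_not_ge h3)]
    show S'.θ (S.f x - (a - 2 * η), g (S.θ (a - 2 * η - S.f x, x))) = _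
    have hxs : S.f x ∈ Ioo S.lo S.hi := ⟨by linarith, by linarith⟩
    have hy : S.f (S.θ (a - 2 * η - S.f x, x)) = a - 2 * η := by
      rw [S.apply_flow hxs ⟨by linarith, by linarith⟩]; ring
    rw [hinv _ (by rw [hy]; exact hca) (by rw [hy]; linarith), hy, S.isFlowOf.map_add,
      show c - (a - 2 * η) + (a - 2 * η - S.f x) = c - S.f x by ring, S'.isFlowOf.map_add,
      show S.f x - (a - 2 * η) + (a - 2 * η - c) = S.f x - c by ring]

end IsLowerPair

/-! ### Iterating: extension from a seed level to any level of the slab -/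

namespace IsLowerPair

variable {S : UnitSlab (n := n) M} {S' : UnitSlab (n := n) M'} {σ c τ : ℝ} {g₀ : M → M'} {g₀' : M' → M}

/-- **A seed is its own flow conjugate** on `c ≤ f < c + 2τ/3` (from the conjugation of the
flows on the seed collar `f⁻¹(c - 2τ/3, c + 2τ/3)`). [folklore] -/
theorem seed_eq_conj (hτ : 0 < τ) (h₀ : IsLowerPair S S' σ (c + τ) (τ / 3) g₀ g₀')
    (hlo : S.lo ≤ c - τ) (hhi : c + τ < S.hi) {x : M} (hcx : c ≤ S.f x) (hx : S.f x < c + 2 * τ / 3) :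
    g₀ x = S'.θ (S.f x - c, g₀ (S.θ (c - S.f x, x))) := by
  have hxs : S.f x ∈ Ioo S.lo S.hi := ⟨by linarith, by linarith⟩
  have hy : S.f (S.θ (c - S.f x, x)) = c := by
    rw [S.apply_flow hxs ⟨by linarith, by linarith⟩]; ring
  have h1 := h₀.g_flow (S.θ (c - S.f x, x)) (S.f x - c) (by rw [hy]; constructor <;> linarith)
    (by rw [hy]; constructor <;> linarith)
  rw [S.isFlowOf.map_add, show S.f x - c + (c - S.f x) = 0 by ring, S.isFlowOf.map_zero] at h1
  exact h1

/-- **Extension of a seed lower pair up the slab.**  A lower pair at the level `c + τ` of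
width `τ/3` (collars `f⁻¹(c - τ, c + τ)`) extends, for every step `η₀ ≤ 5τ/18` and every number
of steps `N` with `c + τ + N η₀` (and `c + τ + τ/3`) still in the slabs, to a lower pair at the
level `c + τ + N η₀` of width `η₀`, agreeing with the seed below the levels `c`, `c + σ`, and
equal to the flow conjugate of the seed on `c ≤ f < c + τ + N η₀`.
[cite: MilnorHCobordism1965, proofs of Thm. 3.4 (PDF p. 13) and Thm. 3.13 (PDF pp. 18–19)] -/
theorem exists_extend (hτ : 0 < τ) (h₀ : IsLowerPair S S' σ (c + τ) (τ / 3) g₀ g₀')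
    (hlo : S.lo ≤ c - τ) (hlo' : S'.lo ≤ c + σ - τ) (hhi : c + τ + τ / 3 ≤ S.hi)
    (hhi' : c + σ + τ + τ / 3 ≤ S'.hi) {η₀ : ℝ} (hη₀ : 0 < η₀) (hη₀τ : 18 * η₀ ≤ 5 * τ) (N : ℕ)
    (hN : c + τ + N * η₀ ≤ S.hi) (hN' : c + σ + τ + N * η₀ ≤ S'.hi) :
    ∃ (g : M → M') (g' : M' → M), IsLowerPair S S' σ (c + τ + N * η₀) η₀ g g' ∧
      (∀ x, S.f x < c → g x = g₀ x) ∧ (∀ y, S'.f y < c + σ → g' y = g₀' y) ∧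
      ∀ x, c ≤ S.f x → S.f x < c + τ + N * η₀ → g x = S'.θ (S.f x - c, g₀ (S.θ (c - S.f x, x))) := by
  have hτ3 : 0 < τ / 3 := by positivity
  -- re-width the seed: a lower pair at the level `c + τ` of width `η₀`
  have hlo₀ : S.lo ≤ c + τ - 6 * (τ / 3) := by linarith
  have hlo₀' : S'.lo ≤ c + τ + σ - 6 * (τ / 3) := by linarith
  have hhi₀ : c + τ + τ / 3 ≤ S.hi := hhi
  have hhi₀' : c + τ + σ + τ / 3 ≤ S'.hi := by linarith
  set L₀ := h₀.lowerData hτ3 hlo₀ hhi₀ hlo₀' hhi₀' with hL₀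
  have hP₀ : IsLowerPair S S' σ (c + τ) η₀ L₀.low L₀.low' :=
    h₀.step hτ3 hlo₀ hhi₀ hlo₀' hhi₀' hη₀ le_rfl (by linarith) (by linarith)
  have hag₀ : ∀ x, S.f x < c → L₀.low x = g₀ x := fun x hx =>
    h₀.low_eq hτ3 hlo₀ hhi₀ hlo₀' hhi₀' (by linarith)
  have hag₀' : ∀ y, S'.f y < c + σ → L₀.low' y = g₀' y := fun y hy =>
    h₀.low'_eq hτ3 hlo₀ hhi₀ hlo₀' hhi₀' (by linarith)
  have hinv₀ : ∀ x, c ≤ S.f x → S.f x < c + τ → L₀.low x = S'.θ (S.f x - c, g₀ (S.θ (c - S.f x, x))) :=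
    fun x hcx hx => h₀.low_eq_conj hτ3 hlo₀ hhi₀ hlo₀' hhi₀' (c := c) (g₀ := g₀) (by linarith)
      (fun y hcy hy => seed_eq_conj hτ h₀ hlo (by linarith) hcy (by linarith)) hcx (by linarith)
  -- climb `k ≤ N` steps of size `η₀`
  have key : ∀ k : ℕ, k ≤ N →
      ∃ (g : M → M') (g' : M' → M), IsLowerPair S S' σ (c + τ + k * η₀) η₀ g g' ∧
        (∀ x, S.f x < c → g x = g₀ x) ∧ (∀ y, S'.f y < c + σ → g' y = g₀' y) ∧
        ∀ x, c ≤ S.f x → S.f x < c + τ + k * η₀ → g x = S'.θ (S.f x - c, g₀ (S.θ (c - S.f x, x))) := by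
    intro k
    induction k with
    | zero =>
      intro _
      refine ⟨L₀.low, L₀.low', by simpa using hP₀, hag₀, hag₀', fun x hcx hx => hinv₀ x hcx ?_⟩
      simpa using hx
    | succ k ih =>
      intro hk
      obtain ⟨g, g', hP, hag, hag', hinv⟩ := ih (Nat.le_of_succ_le hk)
      have hkN : ((k : ℕ) : ℝ) + 1 ≤ N := by exact_mod_cast hk
      have hk0 : (0 : ℝ) ≤ k * η₀ := by positivity
      have hlo₁ : S.lo ≤ c + τ + k * η₀ - 6 * η₀ := by linarith
      have hhi₁ : c + τ + k * η₀ + η₀ ≤ S.hi := by nlinarith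
      have hlo₁' : S'.lo ≤ c + τ + k * η₀ + σ - 6 * η₀ := by linarith
      have hhi₁' : c + τ + k * η₀ + σ + η₀ ≤ S'.hi := by nlinarith
      set L := hP.lowerData hη₀ hlo₁ hhi₁ hlo₁' hhi₁' with hL
      refine ⟨L.low, L.low', ?_, fun x hx => ?_, fun y hy => ?_, fun x hcx hx => ?_⟩
      · have := hP.step hη₀ hlo₁ hhi₁ hlo₁' hhi₁' (a₁ := c + τ + (k + 1 : ℕ) * η₀) (η₁ := η₀) hη₀
          (by push_cast; linarith) (by push_cast; linarith) (by push_cast; linarith)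
        exact this
      · rw [hP.low_eq hη₀ hlo₁ hhi₁ hlo₁' hhi₁' (show S.f x ≤ c + τ + k * η₀ - 3 * η₀ by linarith)]
        exact hag x hx
      · rw [hP.low'_eq hη₀ hlo₁ hhi₁ hlo₁' hhi₁' (show S'.f y ≤ c + τ + k * η₀ + σ - 3 * η₀ by linarith)]
        exact hag' y hy
      · refine hP.low_eq_conj hη₀ hlo₁ hhi₁ hlo₁' hhi₁' (c := c) (g₀ := g₀) (by linarith)
          (fun y hcy hy => hinv y hcy (by linarith)) hcx ?_
        push_cast at hx; linarith
  exact key N le_rfl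

end IsLowerPair

/-! ### The seed: a level-preserving diffeomorphism of sublevel sets -/

section Seed

variable [IsManifold (𝓡∂ (n + 1)) ∞ M] [IsManifold (𝓡∂ (n + 1)) ∞ M'] [T2Space M']
  (S : UnitSlab (n := n) M) (S' : UnitSlab (n := n) M') {b b' : ℝ}
  {hint : ∀ p, S.f p ≤ b → (𝓡∂ (n + 1)).IsInteriorPoint p}
  {hreg : ∀ p, S.f p = b → ¬ IsMCriticalPt (𝓡∂ (n + 1)) S.f p}
  {hint' : ∀ p, S'.f p ≤ b' → (𝓡∂ (n + 1)).IsInteriorPoint p}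
  {hreg' : ∀ p, S'.f p = b' → ¬ IsMCriticalPt (𝓡∂ (n + 1)) S'.f p}
  [csW : ChartedSpace (EuclideanHalfSpace (n + 1)) ↥(S.f ⁻¹' Iic b)]
  [csW' : ChartedSpace (EuclideanHalfSpace (n + 1)) ↥(S'.f ⁻¹' Iic b')]

/-- **The seed lower pair of a level-preserving diffeomorphism of sublevel sets.**  Let
`Ψ₁ : {f ≤ b} ≅ {f' ≤ b'}` satisfy `f' ∘ Ψ₁ = f + σ`, let `c + τ < b`, `c + σ + τ < b'`, the
collar `f⁻¹(c - τ, c + τ]` lie in the slab of `M`, and let the field of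
`M` be `Ψ₁`-related to the (smooth) field of `M'` on `f⁻¹(c - τ, c + τ)`.  Then the ambient maps
of `Ψ₁`, `Ψ₁⁻¹` form a lower pair at the level `c + τ` of width `τ/3`.
[cite: MilnorHCobordism1965, proof of Thm. 3.13 (PDF pp. 18–19)] -/
theorem IsLowerPair.seed (hn : 1 ≤ n) (hcs : csW = (sublevelAtlas S.hf b hint hreg).chartedSpace)
    (hcs' : csW' = (sublevelAtlas S'.hf b' hint' hreg').chartedSpace)
    (Ψ₁ : ↥(S.f ⁻¹' Iic b) ≃ₘ⟮𝓡∂ (n + 1), 𝓡∂ (n + 1)⟯ ↥(S'.f ⁻¹' Iic b')) {σ : ℝ}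
    (hΨ : ∀ x, S'.f (Ψ₁ x) = S.f x + σ) (d : M') (d₀ : M) {c τ : ℝ} (hτ : 0 < τ) (hcb : c + τ < b)
    (hcb' : c + σ + τ < b') (hlo : S.lo ≤ c - τ) (hhi : c + τ ≤ S.hi)
    (hX' : ContMDiff (𝓡∂ (n + 1)) (𝓡∂ (n + 1)).tangent ∞ fun y => (⟨y, S'.X y⟩ : TangentBundle (𝓡∂ (n + 1)) M'))
    (hrel : ∀ x, S.f x ∈ Ioo (c - τ) (c + τ) →
      mfderiv (𝓡∂ (n + 1)) (𝓡∂ (n + 1)) (amb Ψ₁ d) x (S.X x) = S'.X (amb Ψ₁ d x)) :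
    IsLowerPair S S' σ (c + τ) (τ / 3) (amb Ψ₁ d) (ambInv Ψ₁ d₀) := by
  have hΨ' : ∀ y : ↥(S'.f ⁻¹' Iic b'), S.f (Ψ₁.symm y) = S'.f y - σ := fun y => by
    have := hΨ (Ψ₁.symm y); rw [Diffeomorph.apply_symm_apply] at this; linarith
  have hamb : ∀ {x : M}, S.f x ≤ b → S'.f (amb Ψ₁ d x) = S.f x + σ := fun {x} hx => by
    rw [amb, sublevelAmbient_apply hx]; exact hΨ ⟨x, hx⟩
  have hambInv : ∀ {y : M'}, S'.f y ≤ b' → S.f (ambInv Ψ₁ d₀ y) = S'.f y - σ := fun {y} hy => by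
    rw [ambInv, sublevelAmbient_apply hy]; exact hΨ' ⟨y, hy⟩
  -- conjugation of the flows on the collar, by naturality of flows
  have hflow : ∀ x t, S.f x ∈ Ioo (c - τ) (c + τ) → S.f x + t ∈ Ioo (c - τ) (c + τ) →
      amb Ψ₁ d (S.θ (t, x)) = S'.θ (t, amb Ψ₁ d x) := by
    intro x t hx ht
    have h1inf : (1 : ℕ∞ω) ≤ ∞ := by exact_mod_cast le_top
    haveI : IsManifold (𝓡∂ (n + 1)) 1 M' := IsManifold.of_le (n := ∞) h1inf
    have hU : IsOpen {x : M | S.f x ∈ Ioo (c - τ) (c + τ)} := isOpen_Ioo.preimage S.hf.continuous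
    have hg : ContMDiffOn (𝓡∂ (n + 1)) (𝓡∂ (n + 1)) 1 (amb Ψ₁ d) {x : M | S.f x ∈ Ioo (c - τ) (c + τ)} :=
      fun y hy => ((contMDiffAt_amb (Ψ₀ := Ψ₁) (d := d) hn hcs hcs' (by linarith [hy.2])).of_le
        h1inf).contMDiffWithinAt
    have hxs : S.f x ∈ Ioo S.lo S.hi := ⟨by linarith [hx.1], by linarith [hx.2]⟩
    have hmem : ∀ s, s ∈ Icc (min t 0) (max t 0) → S.θ (s, x) ∈ {x : M | S.f x ∈ Ioo (c - τ) (c + τ)} := by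
      intro s hs
      have hs' : S.f x + s ∈ Ioo (c - τ) (c + τ) := by
        rcases le_total 0 t with h0 | h0
        · rw [min_eq_right h0, max_eq_left h0] at hs
          exact ⟨by linarith [hx.1, hs.1], by linarith [ht.2, hs.2]⟩
        · rw [min_eq_left h0, max_eq_right h0] at hs
          exact ⟨by linarith [ht.1, hs.1], by linarith [hx.2, hs.2]⟩
      show S.f (S.θ (s, x)) ∈ Ioo (c - τ) (c + τ)
      rw [S.apply_flow hxs ⟨by linarith [hs'.1], by linarith [hs'.2]⟩]; exact hs'
    exact S.isFlowOf.apply_eq_of_mfderiv_eq_of_Icc S'.isFlowOf (hX'.of_le h1inf) hU hg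
      (fun y hy => hrel y hy) (min_le_right _ _) (le_max_right _ _) hmem ⟨min_le_left _ _, le_max_left _ _⟩
  refine
    { g_smooth := fun x hx => (contMDiffAt_amb (Ψ₀ := Ψ₁) (d := d) hn hcs hcs' (by
        have hx' : S.f x < c + τ := hx
        linarith)).contMDiffWithinAt
      g'_smooth := fun y hy => (contMDiffAt_ambInv (Ψ₀ := Ψ₁) (d₀ := d₀) hn hcs hcs' (by
        have hy' : S'.f y < c + τ + σ := hy
        linarith)).contMDiffWithinAt
      apply_g := fun x hx => hamb (by linarith [hx.2])
      apply_g' := fun y hy => hambInv (by linarith [hy.2])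
      g_below := fun x hx => by rw [hamb (by linarith)]; linarith
      g'_below := fun y hy => by rw [hambInv (by linarith)]; linarith
      g'_g := fun x hx => sublevelAmbient_symm_apply Ψ₁ (by
        have hx' : S.f x < c + τ := hx
        linarith)
      g_g' := fun y hy => ?_
      g_flow := fun x t hx ht => hflow x t ⟨by linarith [hx.1], by linarith [hx.2]⟩
        ⟨by linarith [ht.1], by linarith [ht.2]⟩
      g'_flow := fun y t hy ht => ?_ }
  · -- `amb ∘ ambInv = id` below `b'`
    have hy' : S'.f y < c + τ + σ := hy
    have hyb : S'.f y ≤ b' := by linarith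
    show sublevelAmbient Ψ₁ d (sublevelAmbient Ψ₁.symm d₀ y) = y
    rw [sublevelAmbient_apply hyb, sublevelAmbient_apply (Ψ₁.symm ⟨y, hyb⟩).2]
    simp
  · -- conjugation of the inverse maps, from that of the maps
    have hyb : S'.f y ≤ b' := by linarith [hy.2]
    have hyy : amb Ψ₁ d (ambInv Ψ₁ d₀ y) = y := by
      show sublevelAmbient Ψ₁ d (sublevelAmbient Ψ₁.symm d₀ y) = y
      rw [sublevelAmbient_apply hyb, sublevelAmbient_apply (Ψ₁.symm ⟨y, hyb⟩).2]
      simp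
    have hx : S.f (ambInv Ψ₁ d₀ y) = S'.f y - σ := hambInv hyb
    have h1 := hflow (ambInv Ψ₁ d₀ y) t (by rw [hx]; constructor <;> linarith [hy.1, hy.2])
      (by rw [hx]; constructor <;> linarith [ht.1, ht.2])
    rw [hyy] at h1
    have hlev : S.f (S.θ (t, ambInv Ψ₁ d₀ y)) ≤ b := by
      have hxs : S.f (ambInv Ψ₁ d₀ y) ∈ Ioo S.lo S.hi := by rw [hx]; constructor <;> linarith [hy.1, hy.2]
      rw [S.apply_flow hxs (by rw [hx]; constructor <;> linarith [ht.1, ht.2]), hx]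
      linarith [ht.2]
    rw [← h1]
    exact sublevelAmbient_symm_apply Ψ₁ hlev

end Seed

end Literature.Topology.FourManifolds
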